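import Literature.NumberTheory.EllipticCurves.OrdinaryReductionTorsionLineProofs
import Literature.NumberTheory.EllipticCurves.HasseWeilGoodReductionFrobeniusProofs
import Literature.NumberTheory.EllipticCurves.GeomPointReduction
import HarnessLib

/-!
# The reduction map `E(K̄) → Ẽ_v(k̄_v)` at a place of good (ordinary) reduction above `p`,
# WITH its Frobenius equivariance: `f(σ_v • a) = φ_v • f(a)`

`Proofs` file (theorems only: no definition, no named fact, no `sorry`), topic `NumberTheory/EllipticCurves`;
sequel of `OrdinaryReductionTorsionLineProofs` (`exists_goodReduction_localModel`, `goodReduction_reduction_line`: the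
reduction map `f₀ : E(K̄) → MO~(k_w)` into the `k_w`-points of the reduced local minimal model, `k_w` the residue field of the
spectral valuation ring of `K̄_v`; kernel `Γ_{K_v}`-stable, inertia-invariant, `#(ker f₀ ∩ E[p]) = p` at an ordinary `v ∣ p`) and of
`HasseWeilGoodReductionFrobeniusProofs` (`exists_residueMap`: a residue map `r : 𝒪_w → k̄_v` with kernel `𝔪_w`, compatible with
`𝓞_v → k_v → k̄_v`, carrying an arithmetic Frobenius `σ_v ∈ Γ_{K_v}` at the prime `𝔐` of `\bar 𝓞_v` to `x ↦ x^{q_v}`; there used to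
reduce PRIME-TO-`p` torsion injectively, Silverman VII.3.1(b)).

* `exists_goodReductionHom_frobenius` — for an elliptic curve `W` over a number field `K`, a prime `p`, a place `v ∣ p` of good
  ORDINARY reduction (`p ∤ a_v`), a prime `𝔐` of `\bar 𝓞_v`, an arithmetic Frobenius `σ_v ∈ Γ_{K_v}` at `𝔐` and the `q_v`-power
  Frobenius `φ_v ∈ Γ_{k_v}`: there is a homomorphism `f : E(K̄) → Ẽ_v(k̄_v)` (`geomPoints (W.reductionAt v)`, where the tree's
  Frobenius relation `frobenius_frobenius_sub_trace_smul_add_card_smul` lives) — the composite of `f₀` with the injective map of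
  points along `k_w ↪ k̄_v` induced by `r` — such that: (S) `ker f` is stable under `Γ_{K_v}` (through `absGaloisRestrict K K_v`);
  (I) `f` is invariant under the inertia group `I_{K_v}`; **(F) `f (res σ_v • a) = φ_v • f a` for every `a ∈ E(K̄)`** (Serre 1972 §1.11,
  proof of Prop. 11: "`G` opère sur `Ẽ` par l'intermédiaire de `G → G_k`"; Silverman *AEC* VII.§2, VIII.§1; the `v ∣ p`, all-points
  analogue of `exists_reduceTorsionHom`); (K) `#(ker f ∩ E[p]) = p` (Serre's line `X_p`).

Why (consumer). With (F), Manin's relation on `Ẽ_v(k̄_v)` and the cyclicity of `Ẽ_v[p^k]` give the Frobenius EIGENVALUE on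
`E[p^k]/X` (the unit root of `X² − a_vX + q_v`; `Summits/…/Theorems/FrobeniusUnitRootEigenvalue`), i.e. Greenberg's ordinary
filtration (`ellipticOrdinaryReduction_tateModule_filtration_holds`, inertia characters only) completed by the unramified quotient
character — the cite-level residual `stub_ordinaryFiltrationAtTwo` of crux stmt-BirchSwinnertonDyer-20368
(`EisensteinTwo.finLoc_two_of_ordinaryFiltration`) and the F2-class residue of stmt-BirchSwinnertonDyer-19546. Nothing here asserts those.

References: [SerreInventiones1972] §1.11 Prop. 11 and its proof; [SilvermanAEC2009] Prop. VII.2.1, VII.§2, VIII.§1; [Greenberg1991] §2;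
[DiamondShurman2005] proof of Thm. 9.4.1 (the reduction intertwines Frobenius with Frobenius).
-/

noncomputable section

open scoped Classical NNReal NumberField AddSubgroup
open NumberField IsDedekindDomain Polynomial

namespace Literature.NumberTheory.EllipticCurves

open _root_.WeierstrassCurve Literature.NumberTheory.GaloisRepresentations Field
  IsDedekindDomain.HeightOneSpectrum

set_option autoImplicit false

set_option maxHeartbeats 400000 in
/-- **The reduction map at a good ordinary place above `p`, valued in `Ẽ_v(k̄_v)`, with its Frobenius equivariance.**
`W/K` elliptic over a number field, `p` prime, `v ∣ p` of good ordinary reduction (`p ∤ a_v`), `𝔐` a prime of `\bar 𝓞_v`, `σ_v ∈ Γ_{K_v}`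
an arithmetic Frobenius at `𝔐`, `φ_v ∈ Γ_{k_v}` the `q_v`-power Frobenius. There is a homomorphism `f : E(K̄) → Ẽ_v(k̄_v)` with
(S) `ker f` stable under `Γ_{K_v}`, (I) `f` invariant under `I_{K_v}`, (F) `f (res σ_v • a) = φ_v • f a`, (K) `#(ker f ∩ E[p]) = p`.
Construction: `f = ι_r ∘ f₀` with `f₀ = red ∘ Φ ∘ pointsMap` the reduction at the good local model (`goodReduction_reduction_line`) and
`ι_r` the map of points along the embedding `k_w ↪ k̄_v` induced by the residue map `r` of `exists_residueMap`
(`WeierstrassCurve.mapPointHom`); (F) on coordinates: `r(σ_v z) = r(z)^{q_v}`.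
[cite: SerreInventiones1972, §1.11 Prop. 11 (proof)] [cite: SilvermanAEC2009, Prop. VII.2.1 and VIII.§1]
[cite: DiamondShurman2005, Thm. 9.4.1 (proof)] -/
theorem exists_goodReductionHom_frobenius {K : Type} [Field K] [NumberField K]
    (W : WeierstrassCurve K) [W.IsElliptic] (p : ℕ) [hp : Fact p.Prime]
    (v : HeightOneSpectrum (𝓞 K)) (hpv : (p : 𝓞 K) ∈ v.asIdeal) (hgood : W.HasGoodReductionAt v)
    (hord : ¬ ((p : ℤ) ∣ W.frobeniusTraceAt v))
    {𝔐 : Ideal v.localAbsIntegers} (h𝔐 : 𝔐 ∈ v.localPrimesAbove)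
    {σ : absoluteGaloisGroup (v.adicCompletion K)}
    (hσ : IsArithFrobAt (v.adicCompletionIntegers K) σ 𝔐)
    {φ : absoluteGaloisGroup (IsLocalRing.ResidueField (v.adicCompletionIntegers K))}
    (hφ : ∀ x : AlgebraicClosure (IsLocalRing.ResidueField (v.adicCompletionIntegers K)),
      φ • x = x ^ Nat.card (IsLocalRing.ResidueField (v.adicCompletionIntegers K))) :
    ∃ f : geomPoints W →+ geomPoints (W.reductionAt v),
      (∀ (τ : absoluteGaloisGroup (v.adicCompletion K)) (a : geomPoints W),
          f a = 0 → f (absGaloisRestrict K (v.adicCompletion K) τ • a) = 0) ∧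
      (∀ τ ∈ absInertia (v.adicCompletion K), ∀ a : geomPoints W,
          f (absGaloisRestrict K (v.adicCompletion K) τ • a) = f a) ∧
      (∀ a : geomPoints W, f (absGaloisRestrict K (v.adicCompletion K) σ • a) = φ • f a) ∧
      Nat.card ↥(f.ker ⊓ geomTorsion W p) = p := by
  haveI : CharZero (v.adicCompletion K) :=
    charZero_of_injective_algebraMap (algebraMap K (v.adicCompletion K)).injective
  haveI : CharZero (AlgebraicClosure (v.adicCompletion K)) :=
    charZero_of_injective_algebraMap
      (algebraMap (v.adicCompletion K) (AlgebraicClosure (v.adicCompletion K))).injective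
  /- the local good-reduction setup and the `k_w`-valued reduction map `f₀` -/
  obtain ⟨w, hw, φO, Φ₀, hX, hφO, hΔO, hΦ₀⟩ := exists_goodReduction_localModel W v hgood
  -- notation: `L = K̄_v`, `O = 𝒪_w`, `MO` the `𝒪_w`-model, `red` its reduction homomorphism
  have hvO : w.Integers w.valuationSubring := Valuation.valuationSubring.integers w
  haveI hMOell : ((W.localMinimalIntegralModel v).map φO).IsElliptic := ⟨hΔO⟩
  set f₀ : geomPoints W →+ (((W.localMinimalIntegralModel v).map φO).map
      (IsLocalRing.residue w.valuationSubring)).toAffine.Point :=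
    (goodReductionHom ((W.localMinimalIntegralModel v).map φO) hvO hΔO).comp
      (((Affine.Point.congrEquiv hX).toAddMonoidHom.comp Φ₀.toAddMonoidHom).comp
      (pointsMap W (v.adicCompletion K))) with hf₀def
  have hf₀ : ∀ a : geomPoints W,
      f₀ a = goodReductionHom ((W.localMinimalIntegralModel v).map φO) hvO hΔO
        (Affine.Point.congrEquiv hX (Φ₀ (pointsMap W (v.adicCompletion K) a))) := fun _ ↦ rfl
  obtain ⟨hstab₀, hinv₀, hker₀⟩ :=
    goodReduction_reduction_line W p v hpv hgood hord hw hΔO hX Φ₀ hΦ₀ f₀ hf₀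
  /- the residue map `r : 𝒪_w → k̄_v` and the induced embedding `rbar : k_w ↪ k̄_v` -/
  obtain ⟨r, hr, hrO, hrσ⟩ := exists_residueMap hw h𝔐
  set k := IsLocalRing.ResidueField (v.adicCompletionIntegers K) with hkdef
  let e : w.valuationSubring →+* w.integer :=
    { toFun := fun a ↦ ⟨(a : AlgebraicClosure (v.adicCompletion K)), (Valuation.mem_integer_iff w _).mpr
        ((Valuation.mem_valuationSubring_iff w _).mp a.2)⟩
      map_one' := Subtype.ext rfl
      map_mul' := fun _ _ ↦ Subtype.ext rfl
      map_zero' := Subtype.ext rfl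
      map_add' := fun _ _ ↦ Subtype.ext rfl }
  have he : ∀ a : w.valuationSubring, ((e a : w.integer) : AlgebraicClosure (v.adicCompletion K)) =
      (a : AlgebraicClosure (v.adicCompletion K)) := fun _ ↦ rfl
  set r' : w.valuationSubring →+* AlgebraicClosure k := r.comp e with hr'def
  have hr'0 : ∀ a : w.valuationSubring, r' a = 0 ↔ w (a : AlgebraicClosure (v.adicCompletion K)) < 1 := fun a ↦ by
    rw [hr'def, RingHom.comp_apply, hr, he]
  haveI : IsLocalHom r' := by
    refine ⟨fun a ha ↦ ?_⟩
    rw [hvO.isUnit_iff_valuation_eq_one]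
    have hle : w (a : AlgebraicClosure (v.adicCompletion K)) ≤ 1 := hvO.map_le_one a
    rcases hle.lt_or_eq with hlt | heq
    · exact absurd ((hr'0 a).mpr hlt) ha.ne_zero
    · exact heq
  set rbar : IsLocalRing.ResidueField w.valuationSubring →+* AlgebraicClosure k :=
    IsLocalRing.ResidueField.lift r' with hrbardef
  have hrbar : ∀ a : w.valuationSubring, rbar (IsLocalRing.residue w.valuationSubring a) = r' a := fun a ↦
    IsLocalRing.ResidueField.lift_residue_apply r' a
  /- the reduced curve over `k̄_v` is `Ẽ_v ⊗ k̄_v` -/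
  set Vt : WeierstrassCurve (AlgebraicClosure k) := (W.reductionAt v).baseChange (AlgebraicClosure k) with hVtdef
  have hEv : W.reductionAt v = (W.localMinimalIntegralModel v).map
      (IsLocalRing.residue (v.adicCompletionIntegers K)) := rfl
  have hcoef : ∀ a : v.adicCompletionIntegers K,
      rbar (IsLocalRing.residue w.valuationSubring (φO a)) =
        algebraMap k (AlgebraicClosure k) (IsLocalRing.residue _ a) := by
    intro a
    have ha : w (algebraMap (v.adicCompletion K) (AlgebraicClosure (v.adicCompletion K))
        (algebraMap (v.adicCompletionIntegers K) (v.adicCompletion K) a)) ≤ 1 :=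
      (spectralValuation_algebraMap_le_one_iff hw _).mpr a.2
    rw [hrbar, hr'def, RingHom.comp_apply]
    have hea : e (φO a) = ⟨_, ha⟩ := Subtype.ext (by rw [he]; exact hφO a)
    rw [hea]
    exact hrO a ha
  have hVt : (((W.localMinimalIntegralModel v).map φO).map (IsLocalRing.residue w.valuationSubring)).map rbar = Vt := by
    rw [hVtdef, hEv, WeierstrassCurve.map_map, WeierstrassCurve.map_map, baseChange,
      WeierstrassCurve.map_map]
    ext <;> simp only [WeierstrassCurve.map_a₁, WeierstrassCurve.map_a₂, WeierstrassCurve.map_a₃,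
      WeierstrassCurve.map_a₄, WeierstrassCurve.map_a₆, RingHom.comp_apply] <;> exact hcoef _
  /- the map `f = ι_r ∘ f₀` -/
  set ι : (((W.localMinimalIntegralModel v).map φO).map (IsLocalRing.residue w.valuationSubring)).toAffine.Point →+
      Vt.toAffine.Point :=
    (Affine.Point.congrEquiv hVt).toAddMonoidHom.comp
      ((((W.localMinimalIntegralModel v).map φO).map (IsLocalRing.residue w.valuationSubring)).mapPointHom rbar)
    with hιdef
  have hιinj : Function.Injective ι :=
    (Affine.Point.congrEquiv hVt).injective.comp (mapPointHom_injective _ rbar)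
  have hι0 : ∀ P, ι P = 0 ↔ P = 0 := fun P ↦ by
    rw [← map_zero ι]; exact hιinj.eq_iff
  refine ⟨show geomPoints W →+ geomPoints (W.reductionAt v) from ι.comp f₀, ?_, ?_, ?_, ?_⟩
  · -- (S)
    intro τ a ha
    change ι (f₀ (absGaloisRestrict K (v.adicCompletion K) τ • a)) = 0
    change ι (f₀ a) = 0 at ha
    rw [hι0] at ha ⊢
    exact hstab₀ τ a ha
  · -- (I)
    intro τ hτ a
    change ι (f₀ (absGaloisRestrict K (v.adicCompletion K) τ • a)) = ι (f₀ a)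
    rw [hinv₀ τ hτ a]
  · -- (F): Frobenius equivariance, on coordinates
    intro a
    obtain ⟨σE, hσE⟩ : ∃ σE : AlgebraicClosure (v.adicCompletion K) →ₐ[v.adicCompletion K]
        AlgebraicClosure (v.adicCompletion K),
        σE = ((absoluteGaloisGroup.toAlgEquiv (v.adicCompletion K) σ :
          AlgebraicClosure (v.adicCompletion K) ≃ₐ[v.adicCompletion K] AlgebraicClosure (v.adicCompletion K)) :
            AlgebraicClosure (v.adicCompletion K) →ₐ[v.adicCompletion K] AlgebraicClosure (v.adicCompletion K)) :=
      ⟨_, rfl⟩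
    obtain ⟨φk, hφk⟩ : ∃ φk : AlgebraicClosure k →ₐ[k] AlgebraicClosure k,
        φk = ((absoluteGaloisGroup.toAlgEquiv k φ : AlgebraicClosure k ≃ₐ[k] AlgebraicClosure k) :
          AlgebraicClosure k →ₐ[k] AlgebraicClosure k) := ⟨_, rfl⟩
    have hσEz : ∀ z, σE z = σ • z := fun z ↦ by rw [hσE]; rfl
    have hφkz : ∀ z, φk z = z ^ Nat.card k := fun z ↦ by rw [hφk, ← hφ z]; rfl
    have hσw : ∀ z, w (σE z) = w z := fun z ↦ by rw [hσEz]; exact spectralValuation_smul hw σ z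
    have hφact : ∀ Q : geomPoints (W.reductionAt v), φ • Q = Affine.Point.map φk Q := fun Q ↦ by
      rw [hφk]; rfl
    change ι (f₀ (absGaloisRestrict K (v.adicCompletion K) σ • a)) =
      φ • (show geomPoints (W.reductionAt v) from ι (f₀ a))
    rw [hφact]
    change _ = Affine.Point.map φk (ι (f₀ a))
    have h1 : f₀ (absGaloisRestrict K (v.adicCompletion K) σ • a) =
        goodReductionHom ((W.localMinimalIntegralModel v).map φO) hvO hΔO (Affine.Point.congrEquiv hX (Affine.Point.map σE
          (Φ₀ (pointsMap W (v.adicCompletion K) a)))) := by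
      rw [hf₀, ← resGal_eq_absGaloisRestrict, pointsMap_smul, hΦ₀, hσE]
    rw [h1, hf₀]
    -- the computation on an integral affine point
    have key : ∀ (x₁ y₁ : AlgebraicClosure (v.adicCompletion K)) (hx₁ : w x₁ ≤ 1) (hy₁ : w y₁ ≤ 1)
        (h₁ : (((W.localMinimalIntegralModel v).map φO).baseChange (AlgebraicClosure (v.adicCompletion K))).toAffine.Nonsingular
          x₁ y₁)
        (h₂ : (((W.localMinimalIntegralModel v).map φO).baseChange (AlgebraicClosure (v.adicCompletion K))).toAffine.Nonsingular
          (σE x₁) (σE y₁)),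
        ι (goodReductionHom ((W.localMinimalIntegralModel v).map φO) hvO hΔO (.some (σE x₁) (σE y₁) h₂)) =
          Affine.Point.map φk
            (ι (goodReductionHom ((W.localMinimalIntegralModel v).map φO) hvO hΔO (.some x₁ y₁ h₁))) := by
      intro x₁ y₁ hx₁ hy₁ h₁ h₂
      have hσx₁ : w (σE x₁) ≤ 1 := (hσw x₁).le.trans hx₁
      have hσy₁ : w (σE y₁) ≤ 1 := (hσw y₁).le.trans hy₁
      have hxm : x₁ ∈ w.valuationSubring := (Valuation.mem_valuationSubring_iff w x₁).mpr hx₁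
      have hym : y₁ ∈ w.valuationSubring := (Valuation.mem_valuationSubring_iff w y₁).mpr hy₁
      have hσxm : σE x₁ ∈ w.valuationSubring := (Valuation.mem_valuationSubring_iff w _).mpr hσx₁
      have hσym : σE y₁ ∈ w.valuationSubring := (Valuation.mem_valuationSubring_iff w _).mpr hσy₁
      -- reductions of integral points are the residues of the coordinates
      have red_some : ∀ (x₂ y₂ : AlgebraicClosure (v.adicCompletion K)) (hx₂ : x₂ ∈ w.valuationSubring)
          (hy₂ : y₂ ∈ w.valuationSubring)
          (h₃ : (((W.localMinimalIntegralModel v).map φO).baseChange (AlgebraicClosure (v.adicCompletion K))).toAffine.Nonsingular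
            x₂ y₂),
          ∃ hns, goodReductionHom ((W.localMinimalIntegralModel v).map φO) hvO hΔO (.some x₂ y₂ h₃) =
            .some (IsLocalRing.residue w.valuationSubring ⟨x₂, hx₂⟩)
              (IsLocalRing.residue w.valuationSubring ⟨y₂, hy₂⟩) hns := by
        intro x₂ y₂ hx₂ hy₂ h₃
        have hh : (((W.localMinimalIntegralModel v).map φO).baseChange (AlgebraicClosure (v.adicCompletion K))).toAffine.Nonsingular
            (algebraMap w.valuationSubring (AlgebraicClosure (v.adicCompletion K)) ⟨x₂, hx₂⟩)
            (algebraMap w.valuationSubring (AlgebraicClosure (v.adicCompletion K)) ⟨y₂, hy₂⟩) := h₃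
        have hns := (WeierstrassCurve.hasNonsingularReduction_some_algebraMap_iff hvO.hom_inj hh).mp
          (hasNonsingularReduction_of_isUnit_Δ hvO hΔO _)
        exact ⟨hns, by
          change WeierstrassCurve.reducePoint _ (.some _ _ hh) = _
          exact WeierstrassCurve.reducePoint_some_algebraMap hvO.hom_inj hh hns⟩
      obtain ⟨hns₁, e₁⟩ := red_some x₁ y₁ hxm hym h₁
      obtain ⟨hns₂, e₂⟩ := red_some (σE x₁) (σE y₁) hσxm hσym h₂
      rw [e₁, e₂, hιdef, AddMonoidHom.comp_apply, AddMonoidHom.comp_apply, mapPointHom_some, mapPointHom_some]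
      change Affine.Point.congrEquiv hVt _ = Affine.Point.map φk (Affine.Point.congrEquiv hVt _)
      rw [Affine.Point.congrEquiv_some, Affine.Point.congrEquiv_some, Affine.Point.map_some]
      -- coordinates: `r(σ z) = r(z)^q = φ (r z)`
      have hcoord : ∀ (z : AlgebraicClosure (v.adicCompletion K)) (hz : z ∈ w.valuationSubring)
          (hσz : σE z ∈ w.valuationSubring),
          rbar (IsLocalRing.residue w.valuationSubring ⟨σE z, hσz⟩) =
            φk (rbar (IsLocalRing.residue w.valuationSubring ⟨z, hz⟩)) := by
        intro z hz hσz
        rw [hrbar, hrbar, hφkz, hr'def, RingHom.comp_apply, RingHom.comp_apply]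
        have hz' : w z ≤ 1 := (Valuation.mem_valuationSubring_iff w z).mp hz
        have hσz' : w (σ • ((⟨z, (Valuation.mem_integer_iff w _).mpr hz'⟩ : w.integer) :
            AlgebraicClosure (v.adicCompletion K))) ≤ 1 := by
          change w (σ • z) ≤ 1; rw [← hσEz]; exact (Valuation.mem_valuationSubring_iff w _).mp hσz
        have := hrσ hσ ⟨z, (Valuation.mem_integer_iff w _).mpr hz'⟩ hσz'
        have hea : e ⟨σE z, hσz⟩ = ⟨σ • ((⟨z, (Valuation.mem_integer_iff w _).mpr hz'⟩ : w.integer) :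
            AlgebraicClosure (v.adicCompletion K)), hσz'⟩ := Subtype.ext (by rw [he]; exact hσEz z)
        rw [hea, this]
        rfl
      exact point_some_congr (hcoord x₁ hxm hσxm) (hcoord y₁ hym hσym)
    generalize Φ₀ (pointsMap W (v.adicCompletion K) a) = P
    rcases P with _ | ⟨x, y, h⟩
    · rw [← Affine.Point.zero_def, map_zero, map_zero, map_zero, map_zero, map_zero]
    · have hc₁ := Affine.Point.congrEquiv_some hX h
      have hc₂ : Affine.Point.congrEquiv hX (Affine.Point.map σE (.some x y h)) = .some (σE x) (σE y)
          (hX ▸ (Affine.baseChange_nonsingular _ σE.injective x y).mpr h) := by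
        rw [Affine.Point.map_some]
        exact Affine.Point.congrEquiv_some hX _
      simp only [hc₁, hc₂]
      by_cases hx : w x ≤ 1
      · have h' : (((W.localMinimalIntegralModel v).map φO).baseChange (AlgebraicClosure (v.adicCompletion K))).toAffine.Nonsingular
            x y := by rw [← hX]; exact h
        exact key x y hx (v_Y_le_one_of_v_X_le_one hvO h'.1 hx) _ _
      · -- non-integral point: both sides are `O`
        have hx1 : 1 < w x := not_le.mp hx
        have hσx1 : 1 < w (σE x) := (hσw x).symm ▸ hx1
        have e₁ : ∀ (x₂ y₂ : AlgebraicClosure (v.adicCompletion K)) (hx₂ : 1 < w x₂)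
            (h₃ : (((W.localMinimalIntegralModel v).map φO).baseChange (AlgebraicClosure (v.adicCompletion K))).toAffine.Nonsingular
              x₂ y₂), goodReductionHom ((W.localMinimalIntegralModel v).map φO) hvO hΔO (.some x₂ y₂ h₃) = 0 :=
          fun x₂ y₂ hx₂ h₃ ↦ WeierstrassCurve.reducePoint_some_of_not_mem h₃ ((not_mem_range_iff hvO).mpr hx₂)
        simp only [e₁ _ _ hσx1, e₁ _ _ hx1, map_zero]
  · -- (K): `ker f = ker f₀`
    have hk' : (show geomPoints W →+ geomPoints (W.reductionAt v) from ι.comp f₀).ker = f₀.ker := by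
      ext a
      rw [AddMonoidHom.mem_ker, AddMonoidHom.mem_ker]
      exact hι0 (f₀ a)
    rw [hk']
    exact hker₀

end Literature.NumberTheory.EllipticCurves

end
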